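import Literature.Analysis.Potential.NewtonFarField
import Literature.Analysis.FluidPDE.NewtonPotential
import HarnessLib

/-!
# Green's representation `W = Γ ⋆ ΔW` for functions vanishing at infinity with decaying
# Laplacian, and the monopole expansion of `W` through `ΔW`

`Literature.Geometry.Lorentzian.eq_integral_newtonKernel_mul_laplacian`
(`HarmonicallyFlatProofs.lean`) is Green's representation formula `W(x) = ∫ Γ(x - y) ΔW(y) dy`
(`Γ(z) = -(4π|z|)⁻¹`, Gilbarg–Trudinger (2.17)) for `W ∈ C²(ℝ³)` tending to `0` at infinity whose
Laplacian has *compact support*. In the asymptotic analysis on an asymptotically flat end the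
Laplacian of the (cut-off, chart-transported) unknown does not have compact support — it decays
like the scalar curvature, `O(r⁻⁴)`. This file removes the support hypothesis:

* `eq_integral_newtonKernel_mul_laplacian_of_integrable` — the formula for `W ∈ C²(ℝ³)`, `W → 0`
  at infinity, whenever `y ↦ Γ(x - y) ΔW(y)` is integrable (dominated convergence in the localised
  identity `∫ Γ₀^{ρ,2ρ} Δφ = φ(0) - ∫ λ^{ρ,2ρ} φ` of `FluidPDE/NewtonPotential.lean` as `ρ → ∞`);
* `eq_integral_newtonKernel_mul_laplacian_of_decay` — in particular under `|ΔW| ≤ K(1 + |y|)⁻⁴`;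
* `isBigO_inv_norm_of_laplacian_decay` — hence `W = O(|x|⁻¹)` under `|ΔW| ≤ K(1 + |y|)⁻⁴` alone
  (the flat form of Schoen–Yau's supremum bound (3.9));
* `isBigO_sub_integral_laplacian_mul_inv_norm` — combined with the far-field expansion of
  Newtonian potentials (`NewtonFarField.lean`): if moreover the truncated first moments of `ΔW`
  are bounded, then `W(x) = -(4π)⁻¹ (∫ ΔW) |x|⁻¹ + O(|x|⁻²)` — the flat model of Schoen–Yau's
  `v = A/r + ω`, `A = -(1/4π) ∫ (fv + h)`, `ω = O(r⁻²)` (Comm. Math. Phys. 65 (1979),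
  (3.16)–(3.18)).

All results are proved; nothing is defined and no named fact is introduced.

## References

* D. Gilbarg, N. S. Trudinger, *Elliptic partial differential equations of second order* (2001),
  §2.4, (2.16)–(2.17). [GilbargTrudinger2001]
* R. Schoen, S.-T. Yau, *On the proof of the positive mass conjecture in general relativity*,
  Comm. Math. Phys. 65 (1979) 45–76, Lemma 3.2, (3.12), (3.16)–(3.18). [SchoenYauPMT1979]
-/

noncomputable section

open MeasureTheory Set Filter Topology Real Metric Asymptotics Bornology
open scoped ENNReal InnerProductSpace Laplacian

namespace Literature.Analysis.Potential

open Literature.Analysis.FluidPDE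
open Literature.Geometry.Lorentzian (E3)

/-! ### Green's representation for functions vanishing at infinity -/

/-- **Green's representation formula on `ℝ³` for `C²` functions vanishing at infinity with
integrable source.** If `W ∈ C²(ℝ³)`, `W → 0` at infinity and `y ↦ Γ(x - y) ΔW(y)` is integrable,
then `W(x) = ∫ Γ(x - y) ΔW(y) dy` with `Γ(z) = -(4π|z|)⁻¹` (`newtonKernel`). Gilbarg–Trudinger
(2.17) (printed for compactly supported `W`; `eq_integral_newtonKernel_mul_laplacian` of
`HarmonicallyFlatProofs.lean` for `ΔW` of compact support). Proof: the localised identity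
`∫ Γ₀^{ρ,2ρ}(z) Δφ(z) dz = φ(0) - ∫ λ^{ρ,2ρ}(z) φ(z) dz` (`integral_newtonNear_mul_laplacian`) for
`φ = W(x - ·)`; as `ρ → ∞` the left side tends to `∫ Γ(x - y) ΔW(y) dy` by dominated convergence
(`|Γ₀| ≤ |Γ|`, and `Γ₀^{ρ,2ρ}(z) = Γ(z)` once `ρ ≥ |z|`), and the error is at most
`‖λ^{1,2}‖₁ sup_{|w| ≥ ρ - |x|} |W(w)| → 0`. [cite: GilbargTrudinger2001, (2.17)] -/
theorem eq_integral_newtonKernel_mul_laplacian_of_integrable {W : E3 → ℝ} (hW : ContDiff ℝ 2 W)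
    (hW0 : Tendsto W (cobounded E3) (𝓝 0)) {x : E3}
    (hint : Integrable fun y ↦ newtonKernel (x - y) * (Δ W) y) :
    W x = ∫ y, newtonKernel (x - y) * (Δ W) y := by
  have hΔc : Continuous (Δ W) := FluidPDE.continuous_laplacian hW
  have hL0 : 0 ≤ ∫ w : E3, |newtonFarLaplacian 1 2 w| := integral_nonneg fun _ ↦ abs_nonneg _
  set L : ℝ := ∫ w : E3, |newtonFarLaplacian 1 2 w| with hL
  -- smallness of `W` at infinity
  have hsmall : ∀ ε : ℝ, 0 < ε → ∃ M : ℝ, ∀ w : E3, M ≤ ‖w‖ → |W w| ≤ ε := by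
    intro ε hε
    obtain ⟨M, -, hM⟩ := (Filter.hasBasis_cobounded_norm.tendsto_left_iff.1 hW0)
      (closedBall (0 : ℝ) ε) (closedBall_mem_nhds _ hε)
    refine ⟨M, fun w hw ↦ ?_⟩
    have := hM hw
    rwa [mem_closedBall_zero_iff, Real.norm_eq_abs] at this
  -- the two `ρ`-dependent integrals
  set I : ℝ → ℝ := fun ρ ↦ ∫ y, newtonNear ρ (ρ * 2) (x - y) * (Δ W) y with hI
  set E : ℝ → ℝ := fun ρ ↦ ∫ z, newtonFarLaplacian ρ (ρ * 2) z * W (x - z) with hE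
  -- Green's identity at scale `ρ`
  have key : ∀ ρ : ℝ, 0 < ρ → W x = I ρ + E ρ := by
    intro ρ hρ
    have h₁ : ρ < ρ * 2 := by linarith
    have hφ : ContDiff ℝ 2 fun z : E3 ↦ W (x - z) := hW.comp (contDiff_const.sub contDiff_id)
    have hGreen := integral_newtonNear_mul_laplacian hρ h₁ hφ
    have hlhs : (∫ z, newtonNear ρ (ρ * 2) z * (Δ fun w : E3 ↦ W (x - w)) z) = I ρ := by
      have h1 : (fun z : E3 ↦ newtonNear ρ (ρ * 2) z * (Δ fun w : E3 ↦ W (x - w)) z) =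
          fun z ↦ newtonNear ρ (ρ * 2) z * (Δ W) (x - z) := by
        funext z
        rw [laplacian_comp_const_sub]
      have h2 : (∫ y : E3, newtonNear ρ (ρ * 2) (x - y) * (Δ W) (x - (x - y))) =
          ∫ z : E3, newtonNear ρ (ρ * 2) z * (Δ W) (x - z) :=
        integral_sub_left_eq_self (fun z : E3 ↦ newtonNear ρ (ρ * 2) z * (Δ W) (x - z)) volume x
      rw [h1, ← h2, hI]
      simp only [sub_sub_cancel]
    rw [hlhs] at hGreen
    simp only [sub_zero] at hGreen
    rw [hE]
    linarith
  -- (A) `I ρ → ∫ Γ(x - y) ΔW(y) dy` by dominated convergence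
  have hA : Tendsto I atTop (𝓝 (∫ y, newtonKernel (x - y) * (Δ W) y)) := by
    refine tendsto_integral_filter_of_dominated_convergence (fun y ↦ ‖newtonKernel (x - y) * (Δ W) y‖)
      (Eventually.of_forall fun ρ ↦ ?_) ?_ hint.norm ?_
    · exact (((measurable_newtonNear ρ (ρ * 2)).comp (measurable_id.const_sub x)).mul
        hΔc.measurable).aestronglyMeasurable
    · filter_upwards [eventually_gt_atTop (0 : ℝ)] with ρ hρ
      refine Eventually.of_forall fun y ↦ ?_
      rw [norm_mul, norm_mul, Real.norm_eq_abs, Real.norm_eq_abs, Real.norm_eq_abs,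
        abs_newtonKernel]
      exact mul_le_mul_of_nonneg_right (abs_newtonNear_le _ _ _) (abs_nonneg _)
    · refine Eventually.of_forall fun y ↦ ?_
      refine tendsto_const_nhds.congr' ?_
      filter_upwards [eventually_ge_atTop ‖x - y‖, eventually_gt_atTop (0 : ℝ)] with ρ hρ hρ0
      rw [newtonNear_eq_newtonKernel hρ0.le (by linarith) hρ]
  -- (B) the error tends to zero
  have hB : Tendsto E atTop (𝓝 0) := by
    refine Metric.tendsto_nhds.2 fun ε hε ↦ ?_
    obtain ⟨M, hM⟩ := hsmall (ε / (L + 1)) (div_pos hε (by linarith))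
    filter_upwards [eventually_gt_atTop (0 : ℝ), eventually_ge_atTop (‖x‖ + M)] with ρ hρ hρM
    have h₁ : ρ < ρ * 2 := by linarith
    rw [Real.dist_0_eq_abs]
    have hLρ : (∫ z : E3, |newtonFarLaplacian ρ (ρ * 2) z|) = L := by
      have := integral_abs_newtonFarLaplacian_scale hρ 1 2
      rwa [mul_one] at this
    have hintl : Integrable fun z : E3 ↦ |newtonFarLaplacian ρ (ρ * 2) z| * (ε / (L + 1)) :=
      (integrable_newtonFarLaplacian hρ h₁).abs.mul_const _
    calc |E ρ| = ‖∫ z, newtonFarLaplacian ρ (ρ * 2) z * W (x - z)‖ := (Real.norm_eq_abs _).symm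
      _ ≤ ∫ z, |newtonFarLaplacian ρ (ρ * 2) z| * (ε / (L + 1)) := by
        refine norm_integral_le_of_norm_le hintl (Eventually.of_forall fun z ↦ ?_)
        rw [norm_mul, Real.norm_eq_abs, Real.norm_eq_abs]
        by_cases hz : ‖z‖ < ρ
        · rw [newtonFarLaplacian_eq_zero_of_lt hρ.le h₁ hz]
          simp
        · refine mul_le_mul_of_nonneg_left (hM _ ?_) (abs_nonneg _)
          have hz' := not_lt.1 hz
          have := norm_sub_norm_le z x
          rw [norm_sub_rev] at this
          linarith
      _ = L * (ε / (L + 1)) := by rw [integral_mul_const, hLρ]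
      _ < ε := by
        rw [mul_div_assoc', div_lt_iff₀ (by linarith)]
        nlinarith
  -- conclude: the constant `W x` tends to `∫ Γ ΔW + 0`
  have hsum : Tendsto (fun ρ ↦ I ρ + E ρ) atTop (𝓝 ((∫ y, newtonKernel (x - y) * (Δ W) y) + 0)) :=
    hA.add hB
  rw [add_zero] at hsum
  have hconst : Tendsto (fun _ : ℝ ↦ W x) atTop (𝓝 (∫ y, newtonKernel (x - y) * (Δ W) y)) :=
    hsum.congr' (by filter_upwards [eventually_gt_atTop (0 : ℝ)] with ρ hρ using (key ρ hρ).symm)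
  exact tendsto_nhds_unique tendsto_const_nhds hconst

/-- **Green's representation under quartic decay of the Laplacian**: if `W ∈ C²(ℝ³)`, `W → 0`
at infinity and `|ΔW(y)| ≤ K (1 + |y|)⁻⁴`, then `W(x) = ∫ Γ(x - y) ΔW(y) dy` for every `x`
(the integrand is integrable by `integrable_inv_norm_sub_mul`). [cite: GilbargTrudinger2001, (2.17)] -/
theorem eq_integral_newtonKernel_mul_laplacian_of_decay {W : E3 → ℝ} (hW : ContDiff ℝ 2 W)
    (hW0 : Tendsto W (cobounded E3) (𝓝 0)) {K : ℝ}
    (hΔ : ∀ y, |(Δ W) y| ≤ K * (1 + ‖y‖) ^ (-4 : ℝ)) (x : E3) :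
    W x = ∫ y, newtonKernel (x - y) * (Δ W) y := by
  have hΔc : Continuous (Δ W) := FluidPDE.continuous_laplacian hW
  refine eq_integral_newtonKernel_mul_laplacian_of_integrable hW hW0 ?_
  have h := (integrable_inv_norm_sub_mul hΔc.aestronglyMeasurable hΔ x).const_mul (-(4 * π)⁻¹)
  refine h.congr (ae_of_all _ fun y ↦ ?_)
  simp only [newtonKernel_eq, mul_inv]
  ring

/-- **Monopole expansion of a function through its Laplacian.** If `W ∈ C²(ℝ³)`, `W → 0` at
infinity, `|ΔW(y)| ≤ K(1 + |y|)⁻⁴` and the truncated first moments of `ΔW` are bounded,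
`|∫_{|y|<ρ} ΔW(y) y dy| ≤ K'` (`ρ ≥ 1`), then

  `W(x) = -(4π)⁻¹ (∫ ΔW) |x|⁻¹ + O(|x|⁻²)`   (`|x| → ∞`):

Green's representation `W = Γ ⋆ ΔW` and the far-field expansion of the Newtonian potential
(`integral_newtonKernel_mul_sub_isBigO`). This is the flat model of Schoen–Yau's
`v = A/r + ω`, `A = -(1/4π) ∫ (fv + h)`, `ω = O(r⁻²)` (Comm. Math. Phys. 65 (1979), (3.16)–(3.18)).
[cite: SchoenYauPMT1979, Lemma 3.2, (3.16)–(3.18)] -/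
theorem isBigO_sub_integral_laplacian_mul_inv_norm {W : E3 → ℝ} (hW : ContDiff ℝ 2 W)
    (hW0 : Tendsto W (cobounded E3) (𝓝 0)) {K : ℝ}
    (hΔ : ∀ y, |(Δ W) y| ≤ K * (1 + ‖y‖) ^ (-4 : ℝ)) {K' : ℝ}
    (hmom : ∀ ρ : ℝ, 1 ≤ ρ → ‖∫ y in ball (0 : E3) ρ, (Δ W) y • y‖ ≤ K') :
    (fun x : E3 ↦ W x - (-(4 * π)⁻¹ * ∫ y, (Δ W) y) * ‖x‖⁻¹) =O[cobounded E3]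
      fun x ↦ ‖x‖ ^ (-2 : ℝ) := by
  have hΔc : Continuous (Δ W) := FluidPDE.continuous_laplacian hW
  refine (integral_newtonKernel_mul_sub_isBigO hΔc.aestronglyMeasurable hΔ hmom).congr'
    (Eventually.of_forall fun x ↦ ?_) EventuallyEq.rfl
  simp only
  rw [← eq_integral_newtonKernel_mul_laplacian_of_decay hW hW0 hΔ x]

/-- **Functions vanishing at infinity with quartically decaying Laplacian are `O(1/|x|)`**:
if `W ∈ C²(ℝ³)`, `W → 0` at infinity and `|ΔW(y)| ≤ K(1 + |y|)⁻⁴`, then `W(x) = O(|x|⁻¹)` as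
`|x| → ∞` (Green's representation and `integral_inv_norm_sub_mul_isBigO_inv_norm`; no moment
hypothesis). The flat form of Schoen–Yau's supremum bound `|v| ≤ c₈ r⁻¹` for solutions of
`Δv - fv = h` (Comm. Math. Phys. 65 (1979), (3.5)–(3.9)). [cite: SchoenYauPMT1979, Lemma 3.2, (3.5)–(3.9)] -/
theorem isBigO_inv_norm_of_laplacian_decay {W : E3 → ℝ} (hW : ContDiff ℝ 2 W)
    (hW0 : Tendsto W (cobounded E3) (𝓝 0)) {K : ℝ}
    (hΔ : ∀ y, |(Δ W) y| ≤ K * (1 + ‖y‖) ^ (-4 : ℝ)) :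
    W =O[cobounded E3] fun x : E3 ↦ ‖x‖⁻¹ := by
  have hΔc : Continuous (Δ W) := FluidPDE.continuous_laplacian hW
  have h := (integral_inv_norm_sub_mul_isBigO_inv_norm hΔc.aestronglyMeasurable hΔ).const_mul_left
    (-(4 * π)⁻¹)
  refine h.congr' (Eventually.of_forall fun x ↦ ?_) EventuallyEq.rfl
  simp only
  rw [eq_integral_newtonKernel_mul_laplacian_of_decay hW hW0 hΔ x, ← integral_const_mul]
  refine integral_congr_ae (ae_of_all _ fun y ↦ ?_)
  simp only
  rw [newtonKernel_eq, mul_inv]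
  ring

end Literature.Analysis.Potential
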